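import Literature.AnabelianGeometry.EtaleTheta.Discharge.Sec2MonodromyModelHatScalings
import HarnessLib

/-!
# [EtTh] Prop. 2.6, profinite clause, at the monodromy model — part 3: the scaling automorphisms STABILISE the closures of the
# coordinate subgroups of `TG l` (members of the tower of Prop. 2.4 / Def. 2.5 (ii) and `Π^tp_Ċ`) (proof-only)

S. Mochizuki, *The étale theta function and its Frobenioid-theoretic manifestations* [EtTh], Publ. RIMS **45** (2009), §2
Prop. 2.6, PDF p. 40, last sentence: «A similar statement holds when "`Π^tp`" is replaced by "`Π`".»; Def. 2.5 (ii) p. 39 (the dotted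
tower) [cite: MochizukiEtTh2009, Prop 2.6 p.40] [cite: MochizukiEtTh2009, Def 2.5(ii) p.39].
Cell abc-iut, block F, seat abc-iut-f-142 (gen 13), FACT-LIST row **F-0611** `TemperedCoverData.Prop26_profinite` — instance form at
abc-iut-w6-d084's monodromy model; sequel of parts 1–2 (`Sec2MonodromyModelHatRotationClosure`, `Sec2MonodromyModelHatScalings`).

WHAT IS PROVED. A subgroup `S ≤ TG l` is called coordinate-closed here (spelled out as an explicit conjunction in every statement, no
definition) when it contains the loop `t`, contains with `g = inl(v) · embCu(1, d) · (1, e)` the three normal-form factors, and is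
stable under the scalings `(b, c) ↦ (u b, c)` of its `inl`-part. §1 `coordClosed_heisB0 / _heisD / _heisPiX / _PiCdotT / _inf`: the
coordinate subgroups `{b = 0} = Π^tp_{C̲}`, `{b = c = 0} = Π^tp_{C̲̲}`, `{d a rotation} = Π^tp_X`, `{e = 1} = Π^tp_Ċ` of
abc-iut-w6-d084's `Sec2MonodromyModelDottedMembers.mem_members_iff`, and intersections of such, are coordinate-closed — hence so are
all members `Π^tp_{X̲̲}, Π^tp_{X̲}, Π^tp_{C̲̲}, Π^tp_{C̲}` and their dotted versions. §2 `mapsTo_closure_of_scalingProps`,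
`map_closure_eq_of_scalingProps`: a topological automorphism `T` of `Π_C` mapping `R` into `R`, scaling `η(inl (ℤ/l)²)` on the
`a`-cycle and fixing `η(ι)` and the sheet factor maps `cl(η S)` onto itself for coordinate-closed `S` (normal form + density).
§3 `exists_hatScalingEquiv_stabilising`: the summary consumed by the instance file — for every topological automorphism `ρ` of
`R` a topological automorphism `Σ` of `Π_C` with `Σ|_R = ρ`, `Σ⁻¹|_R = ρ⁻¹`, `Σ(η ι) = η ι`, fixing the sheet factor, scaling the
`a`-cycle, and `Σ(cl η S) = cl η S` for every coordinate-closed `S`.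

HONEST LABEL (abc-iut-L2-lead R1352, inherited from the carrier): «a DESIGNED tempered toy with print's monodromy combinatorics —
loop ↦ `Δ̄^ell` (`b`-cycle), the inversion INVERTS it, unipotent monodromy `x ↦ x·z` on the `a`-cycle, `z` = cusp inertia = `Δ̄_Θ`
central; `G_K := 1`; NOT a Tate curve, NOT the tempered fundamental group of a curve; consistency ≠ faithfulness.» PROOF-ONLY
companion (0 `def`, 0 `instance`, 0 notation, 0 `Prop`-definition; nothing of abc-iut-w6-d084's model files or of abc-iut-L2-t2's
interface is edited or restated). Instance-at-OUR-carrier ≠ [EtTh] Prop. 2.6 for the profinite fundamental groups of a curve;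
typed ≠ proved; no side is taken on [IUTchIII] Cor. 3.12 or on any author; nothing here asserts abc proved or refuted.
-/

noncomputable section

namespace Literature.AnabelianGeometry.EtaleTheta.ThetaCovers.MonodromyModel

open Multiplicative HeisenbergWitness TemperedModel DihedralGroup Topology
open Literature.AnabelianGeometry.SemiGraphs

variable (l : ℕ)

/-! ## 1–3. Coordinate-closed subgroups and the stabilisation of their closures -/

section Stabilise

/-- `{b = 0}` is coordinate-closed: contains `t`, is closed under taking the three normal-form factors, and under scaling the
`a`-cycle. (toy bookkeeping for [EtTh] Def. 2.5 (ii); no claim about print) [cite: MochizukiEtTh2009, Def 2.5(ii) p.39] -/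
theorem coordClosed_heisB0 :
    embCu l (1, r 1) ∈ (heisB0 l).comap (PhiT l) ∧
      (∀ g ∈ (heisB0 l).comap (PhiT l),
        (show TG l from ((SemidirectProduct.inl g.1.left : TG₀ l), (1 : Multiplicative (ZMod 2)))) ∈ (heisB0 l).comap (PhiT l) ∧
        embCu l (1, g.1.right) ∈ (heisB0 l).comap (PhiT l) ∧
        (show TG l from ((1 : TG₀ l), g.2)) ∈ (heisB0 l).comap (PhiT l)) ∧
      (∀ (v : Multiplicative (ZMod l × ZMod l)) (u : (ZMod l)ˣ),
        (show TG l from ((SemidirectProduct.inl v : TG₀ l), (1 : Multiplicative (ZMod 2)))) ∈ (heisB0 l).comap (PhiT l) →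
        (show TG l from ((SemidirectProduct.inl (act l u 0 v) : TG₀ l), (1 : Multiplicative (ZMod 2)))) ∈
          (heisB0 l).comap (PhiT l)) := by
  have m : ∀ g : TG l, g ∈ (heisB0 l).comap (PhiT l) ↔ bC l g = 0 := fun g => (mem_members_iff l g).1
  refine ⟨(m _).mpr (bC_embCu l _), fun g hg => ⟨(m _).mpr ?_, (m _).mpr (bC_embCu l _), (m _).mpr (sheet_coords l g.2).2.1⟩,
    fun v u hv => (m _).mpr ?_⟩
  · rw [(inl_coords l g.1.left).2.1]; exact (m g).mp hg
  · have hv' := (m _).mp hv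
    rw [(inl_coords l v).2.1] at hv'
    rw [(inl_coords l (act l u 0 v)).2.1, toAdd_act_fst, hv', mul_zero]

/-- `{b = c = 0}` is coordinate-closed. (toy bookkeeping for [EtTh] Def. 2.5 (ii); no claim about print)
[cite: MochizukiEtTh2009, Def 2.5(ii) p.39] -/
theorem coordClosed_heisD :
    embCu l (1, r 1) ∈ (heisD l).comap (PhiT l) ∧
      (∀ g ∈ (heisD l).comap (PhiT l),
        (show TG l from ((SemidirectProduct.inl g.1.left : TG₀ l), (1 : Multiplicative (ZMod 2)))) ∈ (heisD l).comap (PhiT l) ∧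
        embCu l (1, g.1.right) ∈ (heisD l).comap (PhiT l) ∧
        (show TG l from ((1 : TG₀ l), g.2)) ∈ (heisD l).comap (PhiT l)) ∧
      (∀ (v : Multiplicative (ZMod l × ZMod l)) (u : (ZMod l)ˣ),
        (show TG l from ((SemidirectProduct.inl v : TG₀ l), (1 : Multiplicative (ZMod 2)))) ∈ (heisD l).comap (PhiT l) →
        (show TG l from ((SemidirectProduct.inl (act l u 0 v) : TG₀ l), (1 : Multiplicative (ZMod 2)))) ∈
          (heisD l).comap (PhiT l)) := by
  have m : ∀ g : TG l, g ∈ (heisD l).comap (PhiT l) ↔ bC l g = 0 ∧ cC l g = 0 := fun g => (mem_members_iff l g).2.1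
  have ht : embCu l (1, r 1) ∈ (heisD l).comap (PhiT l) := (m _).mpr ⟨bC_embCu l _, by rw [cC_embCu]; rfl⟩
  refine ⟨ht, fun g hg => ⟨(m _).mpr ?_, (m _).mpr ⟨bC_embCu l _, by rw [cC_embCu]; rfl⟩,
    (m _).mpr ⟨(sheet_coords l g.2).2.1, (sheet_coords l g.2).2.2.1⟩⟩, fun v u hv => (m _).mpr ?_⟩
  · rw [(inl_coords l g.1.left).2.1, (inl_coords l g.1.left).2.2.1]; exact (m g).mp hg
  · have hv' := (m _).mp hv
    rw [(inl_coords l v).2.1, (inl_coords l v).2.2.1] at hv'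
    rw [(inl_coords l (act l u 0 v)).2.1, (inl_coords l (act l u 0 v)).2.2.1, toAdd_act_fst, toAdd_act_snd, hv'.1, hv'.2,
      mul_zero, mul_zero, add_zero]
    exact ⟨rfl, rfl⟩

/-- The rotation subgroup `Π^tp_X = {d a rotation}` is coordinate-closed. (toy bookkeeping for [EtTh] Def. 2.5 (ii); no claim
about print) [cite: MochizukiEtTh2009, Def 2.5(ii) p.39] -/
theorem coordClosed_heisPiX :
    embCu l (1, r 1) ∈ (heisPiX l).comap (PhiT l) ∧
      (∀ g ∈ (heisPiX l).comap (PhiT l),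
        (show TG l from ((SemidirectProduct.inl g.1.left : TG₀ l), (1 : Multiplicative (ZMod 2)))) ∈ (heisPiX l).comap (PhiT l) ∧
        embCu l (1, g.1.right) ∈ (heisPiX l).comap (PhiT l) ∧
        (show TG l from ((1 : TG₀ l), g.2)) ∈ (heisPiX l).comap (PhiT l)) ∧
      (∀ (v : Multiplicative (ZMod l × ZMod l)) (u : (ZMod l)ˣ),
        (show TG l from ((SemidirectProduct.inl v : TG₀ l), (1 : Multiplicative (ZMod 2)))) ∈ (heisPiX l).comap (PhiT l) →
        (show TG l from ((SemidirectProduct.inl (act l u 0 v) : TG₀ l), (1 : Multiplicative (ZMod 2)))) ∈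
          (heisPiX l).comap (PhiT l)) := by
  have m : ∀ g : TG l, g ∈ (heisPiX l).comap (PhiT l) ↔ ∃ j, g.1.right = r j := fun g => (mem_members_iff l g).2.2.1
  refine ⟨(m _).mpr ⟨1, rfl⟩, fun g hg => ⟨(m _).mpr ⟨0, ?_⟩, (m _).mpr (by rw [embCu_right]; exact (m g).mp hg),
    (m _).mpr ⟨0, ?_⟩⟩, fun v u _ => (m _).mpr ⟨0, ?_⟩⟩
  · rw [(inl_coords l g.1.left).1, one_def]
  · rw [(sheet_coords l g.2).1, one_def]
  · rw [(inl_coords l (act l u 0 v)).1, one_def]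

/-- `Π^tp_Ċ = {e = 1}` is coordinate-closed. (toy bookkeeping for [EtTh] Def. 2.5 (ii); no claim about print)
[cite: MochizukiEtTh2009, Def 2.5(ii) p.39] -/
theorem coordClosed_PiCdotT :
    embCu l (1, r 1) ∈ PiCdotT l ∧
      (∀ g ∈ PiCdotT l,
        (show TG l from ((SemidirectProduct.inl g.1.left : TG₀ l), (1 : Multiplicative (ZMod 2)))) ∈ PiCdotT l ∧
        embCu l (1, g.1.right) ∈ PiCdotT l ∧
        (show TG l from ((1 : TG₀ l), g.2)) ∈ PiCdotT l) ∧
      (∀ (v : Multiplicative (ZMod l × ZMod l)) (u : (ZMod l)ˣ),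
        (show TG l from ((SemidirectProduct.inl v : TG₀ l), (1 : Multiplicative (ZMod 2)))) ∈ PiCdotT l →
        (show TG l from ((SemidirectProduct.inl (act l u 0 v) : TG₀ l), (1 : Multiplicative (ZMod 2)))) ∈ PiCdotT l) := by
  refine ⟨(mem_PiCdotT l).mpr (embCu_snd l _), fun g hg => ⟨(mem_PiCdotT l).mpr (inl_coords l g.1.left).2.2.2,
    (mem_PiCdotT l).mpr (embCu_snd l _), (mem_PiCdotT l).mpr ?_⟩, fun v u _ => (mem_PiCdotT l).mpr (inl_coords l _).2.2.2⟩
  rw [(sheet_coords l g.2).2.2.2]; exact (mem_PiCdotT l).mp hg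

/-- Coordinate-closedness is preserved by intersections. (toy bookkeeping for [EtTh] Def. 2.5 (ii); no claim about print)
[cite: MochizukiEtTh2009, Def 2.5(ii) p.39] -/
theorem coordClosed_inf {S₁ S₂ : Subgroup (TG l)}
    (h₁ : embCu l (1, r 1) ∈ S₁ ∧
      (∀ g ∈ S₁, (show TG l from ((SemidirectProduct.inl g.1.left : TG₀ l), (1 : Multiplicative (ZMod 2)))) ∈ S₁ ∧
        embCu l (1, g.1.right) ∈ S₁ ∧ (show TG l from ((1 : TG₀ l), g.2)) ∈ S₁) ∧
      (∀ (v : Multiplicative (ZMod l × ZMod l)) (u : (ZMod l)ˣ),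
        (show TG l from ((SemidirectProduct.inl v : TG₀ l), (1 : Multiplicative (ZMod 2)))) ∈ S₁ →
        (show TG l from ((SemidirectProduct.inl (act l u 0 v) : TG₀ l), (1 : Multiplicative (ZMod 2)))) ∈ S₁))
    (h₂ : embCu l (1, r 1) ∈ S₂ ∧
      (∀ g ∈ S₂, (show TG l from ((SemidirectProduct.inl g.1.left : TG₀ l), (1 : Multiplicative (ZMod 2)))) ∈ S₂ ∧
        embCu l (1, g.1.right) ∈ S₂ ∧ (show TG l from ((1 : TG₀ l), g.2)) ∈ S₂) ∧
      (∀ (v : Multiplicative (ZMod l × ZMod l)) (u : (ZMod l)ˣ),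
        (show TG l from ((SemidirectProduct.inl v : TG₀ l), (1 : Multiplicative (ZMod 2)))) ∈ S₂ →
        (show TG l from ((SemidirectProduct.inl (act l u 0 v) : TG₀ l), (1 : Multiplicative (ZMod 2)))) ∈ S₂)) :
    embCu l (1, r 1) ∈ S₁ ⊓ S₂ ∧
      (∀ g ∈ S₁ ⊓ S₂, (show TG l from ((SemidirectProduct.inl g.1.left : TG₀ l), (1 : Multiplicative (ZMod 2)))) ∈ S₁ ⊓ S₂ ∧
        embCu l (1, g.1.right) ∈ S₁ ⊓ S₂ ∧ (show TG l from ((1 : TG₀ l), g.2)) ∈ S₁ ⊓ S₂) ∧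
      (∀ (v : Multiplicative (ZMod l × ZMod l)) (u : (ZMod l)ˣ),
        (show TG l from ((SemidirectProduct.inl v : TG₀ l), (1 : Multiplicative (ZMod 2)))) ∈ S₁ ⊓ S₂ →
        (show TG l from ((SemidirectProduct.inl (act l u 0 v) : TG₀ l), (1 : Multiplicative (ZMod 2)))) ∈ S₁ ⊓ S₂) := by
  refine ⟨⟨h₁.1, h₂.1⟩, fun g hg => ⟨⟨(h₁.2.1 g hg.1).1, (h₂.2.1 g hg.2).1⟩, ⟨(h₁.2.1 g hg.1).2.1, (h₂.2.1 g hg.2).2.1⟩,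
    ⟨(h₁.2.1 g hg.1).2.2, (h₂.2.1 g hg.2).2.2⟩⟩, fun v u hv => ⟨h₁.2.2 v u hv.1, h₂.2.2 v u hv.2⟩⟩

/-- **A scaling-type automorphism maps the closure of a coordinate-closed subgroup into itself.** If a topological
automorphism `T` of `Π_C` maps `R` into `R`, scales `η(inl (ℤ/l)²)` by a unit on the `a`-cycle, and fixes `η(ι)` and the sheet
factor, then `T(cl η S) ⊆ cl η S` for every coordinate-closed `S ≤ TG l`. (toy bookkeeping for [EtTh] Prop. 2.6, profinite
clause, at the model; no claim about print) [cite: MochizukiEtTh2009, Prop 2.6 p.40] -/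
theorem mapsTo_closure_of_scalingProps {R : Subgroup (PiC l)}
    (hR : R = ((Subgroup.zpowers (embCu l (1, r 1))).map (toHat l).toMonoidHom).topologicalClosure)
    (T : PiC l ≃ₜ* PiC l) (u : (ZMod l)ˣ) (hTR : ∀ x : ↥R, (T x : PiC l) ∈ R)
    (hTinl : ∀ v, T (toHat l ((SemidirectProduct.inl v : TG₀ l), 1)) = toHat l ((SemidirectProduct.inl (act l u 0 v) : TG₀ l), 1))
    (hTι : T (iotaM l) = iotaM l) (hTe : ∀ e : Multiplicative (ZMod 2), T (toHat l ((1 : TG₀ l), e)) = toHat l ((1 : TG₀ l), e))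
    {S : Subgroup (TG l)}
    (hS : embCu l (1, r 1) ∈ S ∧
      (∀ g ∈ S, (show TG l from ((SemidirectProduct.inl g.1.left : TG₀ l), (1 : Multiplicative (ZMod 2)))) ∈ S ∧
        embCu l (1, g.1.right) ∈ S ∧ (show TG l from ((1 : TG₀ l), g.2)) ∈ S) ∧
      (∀ (v : Multiplicative (ZMod l × ZMod l)) (u : (ZMod l)ˣ),
        (show TG l from ((SemidirectProduct.inl v : TG₀ l), (1 : Multiplicative (ZMod 2)))) ∈ S →
        (show TG l from ((SemidirectProduct.inl (act l u 0 v) : TG₀ l), (1 : Multiplicative (ZMod 2)))) ∈ S)) :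
    ∀ y ∈ (S.map (toHat l).toMonoidHom).topologicalClosure, T y ∈ (S.map (toHat l).toMonoidHom).topologicalClosure := by
  set C := (S.map (toHat l).toMonoidHom).topologicalClosure with hC
  have hηS : ∀ g ∈ S, toHat l g ∈ C := fun g hg => Subgroup.le_topologicalClosure _ ⟨g, hg, rfl⟩
  have hRC : R ≤ C := by
    rw [hR, hC]
    exact Subgroup.topologicalClosure_mono (Subgroup.map_mono ((Subgroup.zpowers_le).mpr hS.1))
  have hTt : T (toHat l (embCu l (1, r 1))) ∈ C := hRC (hTR ⟨_, toHat_t_mem l hR⟩)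
  -- `T(η g) ∈ C` for `g ∈ S`
  have hgen : ∀ g ∈ S, T (toHat l g) ∈ C := by
    intro g hg
    obtain ⟨hA, hB, hE⟩ := hS.2.1 g hg
    rw [eq_inl_mul_embCu_mul_sheet l g, map_mul, map_mul, map_mul, map_mul]
    refine C.mul_mem (C.mul_mem ?_ ?_) ?_
    · change T (toHat l ((SemidirectProduct.inl g.1.left : TG₀ l), 1)) ∈ C
      rw [hTinl]
      exact hηS _ (hS.2.2 _ u hA)
    · rcases hd : g.1.right with i | i
      · rw [(embCu_one_dihedral l i).1, map_zpow, map_zpow]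
        exact C.zpow_mem hTt _
      · rw [(embCu_one_dihedral l i).2, map_mul, map_mul, map_zpow, map_zpow, ← iotaM, hTι]
        refine C.mul_mem ?_ (C.zpow_mem hTt _)
        have hι : iotaT l ∈ S := by
          have h1 : embCu l (1, sr i) ∈ S := hd ▸ hB
          rw [(embCu_one_dihedral l i).2] at h1
          have h2 := S.mul_mem h1 (S.inv_mem (S.zpow_mem hS.1 (show ℤ from i)))
          rwa [mul_inv_cancel_right] at h2
        exact hηS _ hι
    · change T (toHat l ((1 : TG₀ l), g.2)) ∈ C
      rw [hTe]
      exact hηS _ hE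
  -- density
  intro y hy
  have hcl : IsClosed (T ⁻¹' (C : Set (PiC l))) :=
    (Subgroup.isClosed_topologicalClosure (S.map (toHat l).toMonoidHom)).preimage (map_continuous T)
  have hsub : ((S.map (toHat l).toMonoidHom : Subgroup (PiC l)) : Set (PiC l)) ⊆ T ⁻¹' (C : Set (PiC l)) := by
    rintro _ ⟨g, hg, rfl⟩
    exact hgen g hg
  have key := closure_minimal hsub hcl
  rw [← Subgroup.topologicalClosure_coe] at key
  exact key hy

/-- **Stabilisation.** Under the hypotheses of `mapsTo_closure_of_scalingProps` for `T` AND for `T⁻¹`, `T(cl η S) = cl η S`.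
(toy bookkeeping for [EtTh] Prop. 2.6, profinite clause, at the model; no claim about print) [cite: MochizukiEtTh2009, Prop 2.6 p.40] -/
theorem map_closure_eq_of_scalingProps {R : Subgroup (PiC l)}
    (hR : R = ((Subgroup.zpowers (embCu l (1, r 1))).map (toHat l).toMonoidHom).topologicalClosure)
    (T : PiC l ≃ₜ* PiC l) (u u' : (ZMod l)ˣ) (hTR : ∀ x : ↥R, (T x : PiC l) ∈ R) (hTR' : ∀ x : ↥R, (T.symm x : PiC l) ∈ R)
    (hTinl : ∀ v, T (toHat l ((SemidirectProduct.inl v : TG₀ l), 1)) = toHat l ((SemidirectProduct.inl (act l u 0 v) : TG₀ l), 1))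
    (hTinl' : ∀ v, T.symm (toHat l ((SemidirectProduct.inl v : TG₀ l), 1)) =
      toHat l ((SemidirectProduct.inl (act l u' 0 v) : TG₀ l), 1))
    (hTι : T (iotaM l) = iotaM l) (hTι' : T.symm (iotaM l) = iotaM l)
    (hTe : ∀ e : Multiplicative (ZMod 2), T (toHat l ((1 : TG₀ l), e)) = toHat l ((1 : TG₀ l), e))
    (hTe' : ∀ e : Multiplicative (ZMod 2), T.symm (toHat l ((1 : TG₀ l), e)) = toHat l ((1 : TG₀ l), e))
    {S : Subgroup (TG l)}
    (hS : embCu l (1, r 1) ∈ S ∧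
      (∀ g ∈ S, (show TG l from ((SemidirectProduct.inl g.1.left : TG₀ l), (1 : Multiplicative (ZMod 2)))) ∈ S ∧
        embCu l (1, g.1.right) ∈ S ∧ (show TG l from ((1 : TG₀ l), g.2)) ∈ S) ∧
      (∀ (v : Multiplicative (ZMod l × ZMod l)) (u : (ZMod l)ˣ),
        (show TG l from ((SemidirectProduct.inl v : TG₀ l), (1 : Multiplicative (ZMod 2)))) ∈ S →
        (show TG l from ((SemidirectProduct.inl (act l u 0 v) : TG₀ l), (1 : Multiplicative (ZMod 2)))) ∈ S)) :
    ((S.map (toHat l).toMonoidHom).topologicalClosure).map T.toMulEquiv.toMonoidHom =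
      (S.map (toHat l).toMonoidHom).topologicalClosure := by
  have h1 := mapsTo_closure_of_scalingProps l hR T u hTR hTinl hTι hTe hS
  have h2 := mapsTo_closure_of_scalingProps l hR T.symm u' hTR' hTinl' hTι' hTe' hS
  refine le_antisymm ?_ ?_
  · rintro _ ⟨y, hy, rfl⟩
    exact h1 y hy
  · intro y hy
    exact ⟨T.symm y, h2 y hy, T.apply_symm_apply y⟩

variable [NeZero l]

/-- **THE SCALING AUTOMORPHISMS STABILISE THE TOWER'S CLOSURES (summary of this file).** For every topological automorphism
`ρ` of the rotation closure `R = cl(η⟨t⟩) ⊆ Π_C = (TG l)^∧` there is a topological automorphism `Σ` of `Π_C` with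
`Σ|_R = ρ`, `Σ⁻¹|_R = ρ⁻¹`, `Σ(η ι) = η ι`, `Σ` fixing the sheet factor and scaling `η(inl (ℤ/l)²)` on the `a`-cycle, which maps the
closure of `η(S)` onto itself for every coordinate-closed `S ≤ TG l` — in particular for the members `Π^tp_{X̲̲}, Π^tp_{X̲},
Π^tp_{C̲̲}, Π^tp_{C̲}`, their dotted versions and `Π^tp_Ċ` of the monodromy model. (toy bookkeeping for [EtTh] Prop. 2.6,
profinite clause «a similar statement holds when `Π^tp` is replaced by `Π`», at OUR model carrier; no claim about print)
[cite: MochizukiEtTh2009, Prop 2.6 p.40] -/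
theorem exists_hatScalingEquiv_stabilising {R : Subgroup (PiC l)}
    (hR : R = ((Subgroup.zpowers (embCu l (1, r 1))).map (toHat l).toMonoidHom).topologicalClosure)
    (ρ : ↥R ≃ₜ* ↥R) :
    ∃ Sg : PiC l ≃ₜ* PiC l,
      (∀ x : ↥R, Sg x = ρ x) ∧ (∀ x : ↥R, Sg.symm x = ρ.symm x) ∧ Sg (iotaM l) = iotaM l ∧
      (∀ e : Multiplicative (ZMod 2), Sg (toHat l ((1 : TG₀ l), e)) = toHat l ((1 : TG₀ l), e)) ∧
      (∃ u : (ZMod l)ˣ, ∀ v, Sg (toHat l ((SemidirectProduct.inl v : TG₀ l), 1)) =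
        toHat l ((SemidirectProduct.inl (act l u 0 v) : TG₀ l), 1)) ∧
      ∀ S : Subgroup (TG l),
        (embCu l (1, r 1) ∈ S ∧
          (∀ g ∈ S, (show TG l from ((SemidirectProduct.inl g.1.left : TG₀ l), (1 : Multiplicative (ZMod 2)))) ∈ S ∧
            embCu l (1, g.1.right) ∈ S ∧ (show TG l from ((1 : TG₀ l), g.2)) ∈ S) ∧
          (∀ (v : Multiplicative (ZMod l × ZMod l)) (u : (ZMod l)ˣ),
            (show TG l from ((SemidirectProduct.inl v : TG₀ l), (1 : Multiplicative (ZMod 2)))) ∈ S →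
            (show TG l from ((SemidirectProduct.inl (act l u 0 v) : TG₀ l), (1 : Multiplicative (ZMod 2)))) ∈ S)) →
        ((S.map (toHat l).toMonoidHom).topologicalClosure).map Sg.toMulEquiv.toMonoidHom =
          (S.map (toHat l).toMonoidHom).topologicalClosure := by
  obtain ⟨Sg, u, hSR, hSR', hSinl, hSinl', hSι, hSι', hSe, hSe'⟩ := exists_hatScalingEquiv l hR ρ
  refine ⟨Sg, hSR, hSR', hSι, hSe, ⟨u, hSinl⟩, fun S hS => ?_⟩
  exact map_closure_eq_of_scalingProps l hR Sg u u⁻¹ (fun x => by rw [hSR]; exact (ρ x).2)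
    (fun x => by rw [hSR']; exact (ρ.symm x).2) hSinl hSinl' hSι hSι' hSe hSe' hS

end Stabilise

end Literature.AnabelianGeometry.EtaleTheta.ThetaCovers.MonodromyModel

end
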